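/-
Copyright: statement-level skeleton of a published paper (lit-balaban cell, Phase-2 proof seat p39 gen 12). No proof claims
beyond what the kernel checks below.
-/
import Literature.MathematicalPhysics.QuantumFieldTheory.Balaban1983to89.B3WTFreeMeasure
import Literature.MathematicalPhysics.QuantumFieldTheory.Balaban1983to89.B3WTWick

/-!
# B3 — T. Bałaban, *(Higgs)₂,₃ quantum fields in a finite volume. III. Renormalization*, CMP **88** (1983) 411–445
[Balaban1983Higgs3], (2.25)/(2.26) p. 431 [PDF 21]: **Gaussian integrals of field insertions under `dμ_{C^η_{M²}}` AT FREE
BOUNDARY CONDITIONS** — the two-point function `∫⟪φ(x),v⟫⟪φ(y),u⟫dμ = C^η_{M²}(x − y)⟪v,u⟫`, its operator form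
`∫⟪φ(x),Qφ(y)⟫dμ = C^η_{M²}(x − y)·tr Q`, WICK'S THEOREM for four insertions, and THE `q`-CONTRACTION
`∫⟪φ(x₁),qφ(y₁)⟫⟪φ(x₂),qφ(y₂)⟫dμ = tr q²·(C(x₁−y₂)C(y₁−x₂) − C(x₁−x₂)C(y₁−y₂))` behind the two-propagator terms of (2.26) (file 2/3
of the free-boundary Gaussian programme of this seat; 1/3 = `B3WTFreeMeasure` (the measure), 3/3 = `B3WT226FreeGaussian`
((2.25)/(2.26) at free boundary conditions WITH their Gaussian left members))

statement-level skeleton of published theorems with citation tags; proofs where landed; nothing here is a claim about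
the Yang–Mills mass gap

PDF held: `paper:balaban1983-higgs-2-3-quantum-fields-finite-volume` (journal page = PDF page + 410); p. 431 [PDF 21] read on the
×2 render `run/shared/lean/pub/pub-balaban/b2b-balaban-ref1/pages/1983-cmp88-higgs23-III/1983-cmp88-higgs23-III-p021-x2.png`.

CITATION HEADER (lean-in-tree rule).  Part of the lit-balaban TYPED SKELETON (HOME `run/shared/lean/pub/lit-balaban/`), PHASE 2,
proof seat p39 (generation 12).  Rows **B3.Eq2.24-2.25** / **B3.Eq2.26-2.28** of `HOME/lit-balaban-r15/ROWS-B3.md` (fold owner r15).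
These are the free-boundary twins of this seat's torus lemmas `B3WTCovariance.moment2`/`moment2_op`, `B3WTWick.moment4`/`moment_qq`
(there: the Gaussian density `Z⁻¹e^{−½⟨φ,(−Δ^η+M²)φ⟩}dφ` of the finite torus and Gaussian integration by parts; here: the
infinite-volume measure `B3WTFreeMeasure.freeMeasure` and its Wick theorem `integral_linF_mul₄`).  The charge matrix `q`
(antisymmetric, `⟪u,qu⟫ = 0`) and the traces `tr Q = Σ_i⟪e_i,Qe_i⟫` are the model's `HiggsLattice.ChargeData.q`,
`B3WTCovariance.trE`; the trace identities `Σ_{ik}⟪e_i,e_k⟫⟪qe_i,qe_k⟫ = −tr q²`, `Σ_{ik}⟪e_i,qe_k⟫⟪qe_i,e_k⟫ = tr q²` are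
`B3WTWick.sum_inner_mul_inner_qq/_q_q`.

THE PRINTED TEXT (verbatim, p. 431 [PDF 21]): *"… differentiating (2.24) with respect to A, connecting the vertices by properly
localized propagators, and calculating the Gaussian integrals … we get a set of Ward-Takahashi identities. … ∫dμ_{C^η_{M²}}(φ)
[(−e_k⟨∂^ηφ, Aqφ⟩)(:⟨∂^ηφ, ∂^ηλqφ⟩:) − e_k⟨φ, A·∂^ηλq²φ⟩ − e_k⟨∂^ηφ, ηA∂^ηλq²φ⟩] = −e_kΣ_{b,b′}η^{2d}A_b tr q(C^η_{M²}∂^{η*})(b₋,b′)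
q(C^η_{M²}∂^{η*})(b′₋,b)(∂^ηλ)(b′) + … = 0, (2.26) … where now the propagators are C^η_{M²}. … They hold for free boundary
conditions also"*.  *"Calculating the Gaussian integrals"* of products of two and four field insertions under `dμ_{C^η_{M²}}` is
what this file does, at free boundary conditions.

WHAT IS TYPED / PROVED.  §0 `scalarKernel d N C` (the colour-diagonal kernel `δ_{ab}C(x − y)` of a scalar two-point function
`C : ℤ^d → ℝ`), `kernelMeasure d N C` (its centred Gaussian field `dμ_C = gaussianFieldOfKernel`, Kolmogorov extension; probability /
Gaussian / centred / covariance / uniqueness when the kernel is positive semidefinite), `freeKernel_eq_scalarKernel`,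
`freeMeasure_eq_kernelMeasure` (the free measure `dμ_{C^η_{M²}}` of `B3WTFreeMeasure` is the instance `C = C^η_{M²}`, by `rfl`; the
periodic propagators `C_N` of `B3WT226PeriodicLimit.perC` are the other instances of this seat).  §1, for EVERY positive semidefinite
`δ_{ab}C(x − y)` (suffix `K`, hypothesis `hK`) and then for the free instance (names without suffix, `η > 0`, `M² > 0`, statements as
first landed): `fld`, `inner_fld_eq_sum`, `inner_fld_eq_linF` (a field insertion `⟪φ(x),v⟫` is the finitely supported linear functional
with coefficients `cvec x v`), `gram_cvecK`/`gram_cvec` (`G(⟪φ(x),v⟫,⟪φ(y),u⟫) = C(x − y)⟪v,u⟫`);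
* **`integral_inner_fld_inner_fldK`**/`integral_inner_fld_inner_fld` (`= C(x − y)⟪v,u⟫`), **`integral_inner_fld_opK`**/`…_op`
  (`= C(x − y)·tr Q`), **`integral_inner4K`**/`integral_inner4` (Wick for four insertions: `c₁₂c₃₄ + c₁₃c₂₄ + c₁₄c₂₃`,
  `c_{ab} = C(x_a − x_b)⟪v_a,v_b⟫`), **`integral_inner_q_inner_qK`**/`integral_inner_q_inner_q` (the `q`-contraction,
  self-contractions vanish by `⟪u,qu⟫ = 0`), with the integrability of each integrand.
HONEST SCOPE: Gaussian moments only; the identities (2.25)/(2.26) themselves are file 3/3.  Mathlib + the cited tree files only;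
definitions with bodies and theorems, no named fact, no `sorry`; standard axioms.  Unit `lit-balaban-p39-g12`, HOME
`run/shared/lean/pub/lit-balaban/`, 2026-08-22.

References: [Balaban1983Higgs3] CMP 88 (1983), (2.25)–(2.26) p. 431; [Janson1997] S. Janson, *Gaussian Hilbert Spaces*, Thm 1.28.
-/

noncomputable section

open scoped BigOperators InnerProductSpace Matrix
open MeasureTheory ProbabilityTheory Finset

namespace Literature.MathematicalPhysics.QuantumFieldTheory.Balaban1983to89.B3WTFreeWick

open B3Sect3VectorSelfEnergy B3CxiPropagator B3WT226FreeLattice B3WTFreeMeasure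
open Literature.MathematicalPhysics.QuantumFieldTheory

variable {d N : ℕ}

/-! ## §0 Colour-diagonal translation-invariant kernels `δ_{ab}C(x − y)` on `ℤ^d × {1,…,N}` and their centred Gaussian fields
(the free measure `dμ_{C^η_{M²}}` of `B3WTFreeMeasure` is the instance `C = C^η_{M²}`; the `N`-periodic propagators `C_N` of
`B3WT226PeriodicLimit.perC` — the torus fields extended periodically, p. 431 *"a limit of the identities with periodic boundary
conditions"* — are the other instances this seat uses) -/

section Kernels

/-- the colour-diagonal kernel `K_C((x,a),(y,b)) = δ_{ab}·C(x − y)` of a scalar two-point function `C : ℤ^d → ℝ`.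
[cite: Balaban1983Higgs3, (2.26) p.431] -/
def scalarKernel (d N : ℕ) (Cf : ZSite d → ℝ) (p q : Idx d N) : ℝ := if p.2 = q.2 then Cf (p.1 - q.1) else 0

variable {Cf : ZSite d → ℝ} {η M2 : ℝ}

/-- unfolding. [cite: Balaban1983Higgs3, (2.26) p.431] -/
theorem scalarKernel_apply (p q : Idx d N) : scalarKernel d N Cf p q = if p.2 = q.2 then Cf (p.1 - q.1) else 0 := rfl

/-- the kernel `δ_{ab}C(x − y)` is symmetric when `C` is even. [cite: Balaban1983Higgs3, (2.26) p.431] -/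
theorem scalarKernel_comm (hCeven : ∀ z, Cf (-z) = Cf z) (p q : Idx d N) :
    scalarKernel d N Cf p q = scalarKernel d N Cf q p := by
  unfold scalarKernel
  by_cases h : p.2 = q.2
  · rw [if_pos h, if_pos h.symm, ← hCeven, neg_sub]
  · rw [if_neg h, if_neg (Ne.symm h)]

/-- **criterion**: `δ_{ab}C(x − y)` is a positive semidefinite kernel as soon as `C` is even and positive semidefinite along
finite families of sites (`Σ_{jj′}c_jc_{j′}C(g_j − g_{j′}) ≥ 0`) — block-diagonal extension over the colours
(`sum_sum_mul_mul_ite_nonneg`); every finite Gram matrix is then positive semidefinite and the Gaussian marginals are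
consistent (Kallenberg Lemma 13.1). [cite: Kallenberg2002, Lemma 13.1] -/
theorem isPosSemidefKernel_scalarKernel (hCeven : ∀ z, Cf (-z) = Cf z)
    (h : ∀ (J : Type) [Fintype J] (g : J → ZSite d) (c : J → ℝ), 0 ≤ ∑ j, ∑ j', c j * c j' * Cf (g j - g j')) :
    IsPosSemidefKernel (scalarKernel d N Cf) := by
  intro I
  refine Matrix.PosSemidef.of_dotProduct_mulVec_nonneg (Matrix.IsHermitian.ext fun s t => ?_) fun x => ?_
  · simp only [covGram_apply, star_trivial]
    exact scalarKernel_comm hCeven _ _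
  · rw [star_trivial]
    have expand : x ⬝ᵥ (covGram (scalarKernel d N Cf) I *ᵥ x) =
        ∑ j : I, ∑ j' : I, x j * x j' *
          (if (j : Idx d N).2 = (j' : Idx d N).2 then Cf ((j : Idx d N).1 - (j' : Idx d N).1) else 0) := by
      simp only [dotProduct, Matrix.mulVec, covGram_apply, scalarKernel_apply, Finset.mul_sum]
      refine Finset.sum_congr rfl fun j _ => Finset.sum_congr rfl fun j' _ => ?_
      ring
    rw [expand]
    exact sum_sum_mul_mul_ite_nonneg (fun x y : ZSite d => Cf (x - y)) h
      (fun j : I => (j : Idx d N).1) (fun j : I => (j : Idx d N).2) x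

/-- the free kernel `δ_{ab}C^η_{M²}(x − y)` of `B3WTFreeMeasure` is the instance `C = C^η_{M²}` (definitionally).
[cite: Balaban1983Higgs3, (2.26) p.431] -/
theorem freeKernel_eq_scalarKernel (d N : ℕ) (η M2 : ℝ) : freeKernel d N η M2 = scalarKernel d N (CetaM d η M2) := rfl

/-- **the centred Gaussian field `dμ_C` on `ℤ^d × {1,…,N}` with covariance `δ_{ab}C(x − y)`** (Kolmogorov extension of the consistent
centred Gaussian marginals, `gaussianFieldOfKernel`; meaningful when the kernel is positive semidefinite). [cite: Kallenberg2002, Lemma 13.1] -/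
def kernelMeasure (d N : ℕ) (Cf : ZSite d → ℝ) : Measure (Cfg d N) := gaussianFieldOfKernel (scalarKernel d N Cf)

/-- the free measure `dμ_{C^η_{M²}}` is the instance `C = C^η_{M²}` (definitionally). [cite: Balaban1983Higgs3, (2.25) p.431] -/
theorem freeMeasure_eq_kernelMeasure (d N : ℕ) (η M2 : ℝ) : freeMeasure d N η M2 = kernelMeasure d N (CetaM d η M2) := rfl

/-- `dμ_C` is a probability measure. [cite: Kallenberg2002, Lemma 13.1] -/
theorem isProbabilityMeasure_kernelMeasure (hK : IsPosSemidefKernel (scalarKernel d N Cf)) :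
    IsProbabilityMeasure (kernelMeasure d N Cf) :=
  isProbabilityMeasure_gaussianFieldOfKernel hK

/-- the coordinate process is Gaussian under `dμ_C`. [cite: Kallenberg2002, Lemma 13.1] -/
theorem isGaussianProcess_kernelMeasure (hK : IsPosSemidefKernel (scalarKernel d N Cf)) :
    IsGaussianProcess (fun (p : Idx d N) (ω : Cfg d N) => ω p) (kernelMeasure d N Cf) :=
  isGaussianProcess_eval_gaussianFieldOfKernel hK

/-- `dμ_C` is centred. [cite: Kallenberg2002, Lemma 13.1] -/
theorem integral_eval_kernelMeasure (hK : IsPosSemidefKernel (scalarKernel d N Cf)) (p : Idx d N) :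
    ∫ ω, ω p ∂kernelMeasure d N Cf = 0 :=
  integral_eval_gaussianFieldOfKernel hK p

/-- the covariance of `dμ_C` is `δ_{ab}C(x − y)`. [cite: Kallenberg2002, Lemma 13.1] -/
theorem covariance_eval_kernelMeasure (hK : IsPosSemidefKernel (scalarKernel d N Cf)) (p q : Idx d N) :
    cov[fun ω => ω p, fun ω => ω q; kernelMeasure d N Cf] = scalarKernel d N Cf p q :=
  covariance_eval_gaussianFieldOfKernel hK p q

/-- **uniqueness**: a probability measure under which the coordinates form a centred Gaussian process with covariance
`δ_{ab}C(x − y)` IS `dμ_C`. [cite: Kallenberg2002, Lemma 13.1] -/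
theorem eq_kernelMeasure_of_isGaussianProcess (hK : IsPosSemidefKernel (scalarKernel d N Cf)) {ν : Measure (Cfg d N)}
    [IsProbabilityMeasure ν] (hG : IsGaussianProcess (fun (p : Idx d N) (ω : Cfg d N) => ω p) ν) (hm : ∀ p, ∫ ω, ω p ∂ν = 0)
    (hc : ∀ p q, cov[fun ω => ω p, fun ω => ω q; ν] = scalarKernel d N Cf p q) : ν = kernelMeasure d N Cf :=
  eq_gaussianFieldOfKernel_of_isGaussianProcess hK hG hm hc

end Kernels

/-! ## §1 The field `φ(x) ∈ R^N` under `dμ_{C^η_{M²}}`: insertions as linear functionals, two-point functions, the operator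
form, Wick's theorem for four field insertions, and the `q`-contraction of (2.26) -/

section Fields

open B3WTCovariance (trE)
open B3WTWick B3WT226Pairings

variable (C : HiggsLattice.ChargeData N) {Cf : ZSite d → ℝ} {η M2 : ℝ}

/-- the scalar field at the site `x` as a vector of `R^N`: `φ(x)_a = ω(x, a)`. [cite: Balaban1983Higgs3, (2.23) p.430] -/
def fld (ω : Cfg d N) (x : ZSite d) : EuclideanSpace ℝ (Fin N) := WithLp.toLp 2 fun a => ω (x, a)

omit C in
/-- components of the field. [cite: Balaban1983Higgs3, (2.23) p.430] -/
@[simp] theorem fld_apply (ω : Cfg d N) (x : ZSite d) (a : Fin N) : fld ω x a = ω (x, a) := rfl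

omit C in
/-- `⟪φ(x), v⟫ = Σ_a φ_a(x)v_a`. [cite: Balaban1983Higgs3, (2.25) p.431] -/
theorem inner_fld_eq_sum (ω : Cfg d N) (x : ZSite d) (v : EuclideanSpace ℝ (Fin N)) :
    ⟪fld ω x, v⟫_ℝ = ∑ a : Fin N, ω (x, a) * v a := by
  rw [EuclideanSpace.inner_eq_star_dotProduct]
  simp [dotProduct, fld, mul_comm]

omit C in
/-- the field insertions are measurable. [cite: Balaban1983Higgs3, (2.25) p.431] -/
@[fun_prop]
theorem measurable_inner_fld (x : ZSite d) (v : EuclideanSpace ℝ (Fin N)) :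
    Measurable fun ω : Cfg d N => ⟪fld ω x, v⟫_ℝ := by
  simp_rw [inner_fld_eq_sum]
  exact Finset.measurable_sum _ fun a _ => (measurable_pi_apply (x, a)).mul measurable_const

/-- the coefficient function of the functional `⟪φ(x), v⟫`: `(y, a) ↦ [y = x]v_a`. [cite: Balaban1983Higgs3, (2.25) p.431] -/
def cvec (x : ZSite d) (v : EuclideanSpace ℝ (Fin N)) : Idx d N → ℝ := fun p => if p.1 = x then v p.2 else 0

omit C in
/-- `⟪φ(x), v⟫` is the finitely supported linear functional with coefficients `cvec x v` (on any window containing `x`).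
[cite: Balaban1983Higgs3, (2.25) p.431] -/
theorem inner_fld_eq_linF {S₀ : Finset (ZSite d)} {x : ZSite d} (hx : x ∈ S₀) (v : EuclideanSpace ℝ (Fin N))
    (ω : Cfg d N) : ⟪fld ω x, v⟫_ℝ = linF (S₀ ×ˢ (Finset.univ : Finset (Fin N))) (cvec x v) ω := by
  rw [inner_fld_eq_sum, linF, Finset.sum_product]
  simp only [cvec]
  rw [Finset.sum_eq_single_of_mem x hx (fun y _ hy => by simp [hy])]
  simp only [if_true]
  exact Finset.sum_congr rfl fun a _ => mul_comm _ _

omit C in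
/-- the Gram form of two field insertions: `G(⟪φ(x),v⟫, ⟪φ(y),u⟫) = C(x − y)⟪v, u⟫`. [cite: Balaban1983Higgs3, (2.26) p.431] -/
theorem gram_cvecK {S₀ : Finset (ZSite d)} {x y : ZSite d} (hx : x ∈ S₀) (hy : y ∈ S₀)
    (v u : EuclideanSpace ℝ (Fin N)) :
    gram (scalarKernel d N Cf) (S₀ ×ˢ (Finset.univ : Finset (Fin N))) (cvec x v) (cvec y u) =
      Cf (x - y) * ⟪v, u⟫_ℝ := by
  unfold gram
  have inner_sum : ∀ p : Idx d N, ∑ q ∈ S₀ ×ˢ (Finset.univ : Finset (Fin N)),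
      cvec x v p * cvec y u q * scalarKernel d N Cf p q = cvec x v p * (u p.2 * Cf (p.1 - y)) := by
    intro p
    rw [Finset.sum_product]
    simp only [cvec, scalarKernel_apply]
    rw [Finset.sum_eq_single_of_mem y hy (fun y' _ hy' => by simp [hy'])]
    simp only [if_true]
    rw [Finset.sum_eq_single_of_mem p.2 (Finset.mem_univ _) (fun b _ hb => by simp [Ne.symm hb])]
    by_cases hp : p.1 = x <;> simp [hp, mul_assoc]
  simp_rw [inner_sum]
  rw [Finset.sum_product]
  simp only [cvec]
  rw [Finset.sum_eq_single_of_mem x hx (fun x' _ hx' => by simp [hx'])]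
  simp only [if_true]
  rw [EuclideanSpace.inner_eq_star_dotProduct]
  simp only [dotProduct, Finset.mul_sum]
  simp [mul_comm, mul_assoc]

omit C in
/-- **the two-point function of the field for the Gaussian field of a colour-diagonal kernel `δ_{ab}C(x − y)`**: `∫⟪φ(x),v⟫⟪φ(y),u⟫dμ_C = C(x − y)⟪v,u⟫`.
[cite: Balaban1983Higgs3, (2.26) p.431] -/
theorem integral_inner_fld_inner_fldK (hK : IsPosSemidefKernel (scalarKernel d N Cf)) (x y : ZSite d) (v u : EuclideanSpace ℝ (Fin N)) :
    ∫ ω, ⟪fld ω x, v⟫_ℝ * ⟪fld ω y, u⟫_ℝ ∂kernelMeasure d N Cf = Cf (x - y) * ⟪v, u⟫_ℝ := by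
  have hx : x ∈ ({x, y} : Finset (ZSite d)) := by simp
  have hy : y ∈ ({x, y} : Finset (ZSite d)) := by simp
  simp_rw [inner_fld_eq_linF hx, inner_fld_eq_linF hy]
  rw [kernelMeasure, integral_linF_mul_linF (hK), gram_cvecK hx hy]

omit C in
/-- integrability of the product of two field insertions. [cite: Balaban1983Higgs3, (2.26) p.431] -/
theorem integrable_inner_fld_inner_fldK (hK : IsPosSemidefKernel (scalarKernel d N Cf)) (x y : ZSite d) (v u : EuclideanSpace ℝ (Fin N)) :
    Integrable (fun ω => ⟪fld ω x, v⟫_ℝ * ⟪fld ω y, u⟫_ℝ) (kernelMeasure d N Cf) := by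
  have hx : x ∈ ({x, y} : Finset (ZSite d)) := by simp
  have hy : y ∈ ({x, y} : Finset (ZSite d)) := by simp
  simp_rw [inner_fld_eq_linF hx, inner_fld_eq_linF hy]
  exact integrable_linF_mul_linF (hK) _ _ _

omit C in
/-- **operator form of the two-point function**: `∫⟪φ(x),Qφ(y)⟫dμ_C = C(x − y)·tr Q` for every operator `Q` on
`R^N` (e.g. `Q = q²`: the single-propagator terms of (2.26)). [cite: Balaban1983Higgs3, (2.26) p.431] -/
theorem integral_inner_fld_opK (hK : IsPosSemidefKernel (scalarKernel d N Cf)) (x y : ZSite d)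
    (Q : EuclideanSpace ℝ (Fin N) →L[ℝ] EuclideanSpace ℝ (Fin N)) :
    ∫ ω, ⟪fld ω x, Q (fld ω y)⟫_ℝ ∂kernelMeasure d N Cf = Cf (x - y) * trE Q := by
  set e := EuclideanSpace.basisFun (Fin N) ℝ with he
  have hexp : ∀ ω : Cfg d N, ⟪fld ω x, Q (fld ω y)⟫_ℝ =
      ∑ i : Fin N, ⟪fld ω x, e i⟫_ℝ * ⟪fld ω y, (ContinuousLinearMap.adjoint Q) (e i)⟫_ℝ := by
    intro ω
    rw [← e.sum_inner_mul_inner (fld ω x) (Q (fld ω y))]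
    refine Finset.sum_congr rfl fun i _ => ?_
    rw [← ContinuousLinearMap.adjoint_inner_left, real_inner_comm (fld ω y)]
  simp_rw [hexp]
  rw [integral_finsetSum _ (fun i _ => integrable_inner_fld_inner_fldK hK x y _ _)]
  simp_rw [integral_inner_fld_inner_fldK hK]
  rw [trE, Finset.mul_sum]
  refine Finset.sum_congr rfl fun i _ => ?_
  rw [← he, ContinuousLinearMap.adjoint_inner_right, real_inner_comm (e i)]

omit C in
/-- integrability of `⟪φ(x),Qφ(y)⟫`. [cite: Balaban1983Higgs3, (2.26) p.431] -/
theorem integrable_inner_fld_opK (hK : IsPosSemidefKernel (scalarKernel d N Cf)) (x y : ZSite d)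
    (Q : EuclideanSpace ℝ (Fin N) →L[ℝ] EuclideanSpace ℝ (Fin N)) :
    Integrable (fun ω => ⟪fld ω x, Q (fld ω y)⟫_ℝ) (kernelMeasure d N Cf) := by
  set e := EuclideanSpace.basisFun (Fin N) ℝ with he
  have hexp : (fun ω : Cfg d N => ⟪fld ω x, Q (fld ω y)⟫_ℝ) = fun ω =>
      ∑ i : Fin N, ⟪fld ω x, e i⟫_ℝ * ⟪fld ω y, (ContinuousLinearMap.adjoint Q) (e i)⟫_ℝ := by
    funext ω
    rw [← e.sum_inner_mul_inner (fld ω x) (Q (fld ω y))]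
    refine Finset.sum_congr rfl fun i _ => ?_
    rw [← ContinuousLinearMap.adjoint_inner_left, real_inner_comm (fld ω y)]
  rw [hexp]
  exact integrable_finsetSum _ fun i _ => integrable_inner_fld_inner_fldK hK x y _ _

omit C in
/-- **WICK'S THEOREM FOR FOUR FIELD INSERTIONS for the Gaussian field of a colour-diagonal kernel `δ_{ab}C(x − y)`**: for `ℓ_a = ⟪φ(x_a),v_a⟫` and
`c_{ab} = C(x_a − x_b)⟪v_a,v_b⟫`, `∫ℓ₁ℓ₂ℓ₃ℓ₄ dμ_C = c₁₂c₃₄ + c₁₃c₂₄ + c₁₄c₂₃` (the torus file's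
`B3WTWick.moment4`, now for the infinite-volume measure). [cite: Balaban1983Higgs3, (2.26) p.431] -/
theorem integral_inner4K (hK : IsPosSemidefKernel (scalarKernel d N Cf)) (x₁ x₂ x₃ x₄ : ZSite d) (v₁ v₂ v₃ v₄ : EuclideanSpace ℝ (Fin N)) :
    ∫ ω, ⟪fld ω x₁, v₁⟫_ℝ * (⟪fld ω x₂, v₂⟫_ℝ * (⟪fld ω x₃, v₃⟫_ℝ * ⟪fld ω x₄, v₄⟫_ℝ)) ∂kernelMeasure d N Cf =
      Cf (x₁ - x₂) * ⟪v₁, v₂⟫_ℝ * (Cf (x₃ - x₄) * ⟪v₃, v₄⟫_ℝ)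
        + Cf (x₁ - x₃) * ⟪v₁, v₃⟫_ℝ * (Cf (x₂ - x₄) * ⟪v₂, v₄⟫_ℝ)
        + Cf (x₁ - x₄) * ⟪v₁, v₄⟫_ℝ * (Cf (x₂ - x₃) * ⟪v₂, v₃⟫_ℝ) := by
  set S₀ : Finset (ZSite d) := {x₁, x₂, x₃, x₄} with hS₀
  have h1 : x₁ ∈ S₀ := by simp [hS₀]
  have h2 : x₂ ∈ S₀ := by simp [hS₀]
  have h3 : x₃ ∈ S₀ := by simp [hS₀]
  have h4 : x₄ ∈ S₀ := by simp [hS₀]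
  simp_rw [inner_fld_eq_linF h1, inner_fld_eq_linF h2, inner_fld_eq_linF h3, inner_fld_eq_linF h4]
  have hassoc : ∀ ω : Cfg d N, linF (S₀ ×ˢ Finset.univ) (cvec x₁ v₁) ω * (linF (S₀ ×ˢ Finset.univ) (cvec x₂ v₂) ω *
      (linF (S₀ ×ˢ Finset.univ) (cvec x₃ v₃) ω * linF (S₀ ×ˢ Finset.univ) (cvec x₄ v₄) ω)) =
      linF (S₀ ×ˢ Finset.univ) (cvec x₁ v₁) ω * linF (S₀ ×ˢ Finset.univ) (cvec x₂ v₂) ω *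
        linF (S₀ ×ˢ Finset.univ) (cvec x₃ v₃) ω * linF (S₀ ×ˢ Finset.univ) (cvec x₄ v₄) ω := fun ω => by ring
  simp_rw [hassoc]
  rw [kernelMeasure, integral_linF_mul₄ hK, gram_cvecK h1 h2, gram_cvecK h3 h4, gram_cvecK h1 h3, gram_cvecK h2 h4,
    gram_cvecK h1 h4, gram_cvecK h2 h3]

omit C in
/-- integrability of the product of four field insertions. [cite: Balaban1983Higgs3, (2.26) p.431] -/
theorem integrable_inner4K (hK : IsPosSemidefKernel (scalarKernel d N Cf)) (x₁ x₂ x₃ x₄ : ZSite d) (v₁ v₂ v₃ v₄ : EuclideanSpace ℝ (Fin N)) :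
    Integrable (fun ω => ⟪fld ω x₁, v₁⟫_ℝ * (⟪fld ω x₂, v₂⟫_ℝ * (⟪fld ω x₃, v₃⟫_ℝ * ⟪fld ω x₄, v₄⟫_ℝ)))
      (kernelMeasure d N Cf) := by
  set S₀ : Finset (ZSite d) := {x₁, x₂, x₃, x₄} with hS₀
  have h1 : x₁ ∈ S₀ := by simp [hS₀]
  have h2 : x₂ ∈ S₀ := by simp [hS₀]
  have h3 : x₃ ∈ S₀ := by simp [hS₀]
  have h4 : x₄ ∈ S₀ := by simp [hS₀]
  simp_rw [inner_fld_eq_linF h1, inner_fld_eq_linF h2, inner_fld_eq_linF h3, inner_fld_eq_linF h4]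
  refine (integrable_linF_mul₄ hK (S₀ ×ˢ (Finset.univ : Finset (Fin N))) (cvec x₁ v₁) (cvec x₂ v₂) (cvec x₃ v₃)
    (cvec x₄ v₄)).congr (ae_of_all _ fun ω => ?_)
  simp only
  ring

/-- integrability of the `q`-contraction integrand. [cite: Balaban1983Higgs3, (2.26) p.431] -/
theorem integrable_inner_q_inner_qK (hK : IsPosSemidefKernel (scalarKernel d N Cf)) (x₁ y₁ x₂ y₂ : ZSite d) :
    Integrable (fun ω => ⟪fld ω x₁, C.q (fld ω y₁)⟫_ℝ * ⟪fld ω x₂, C.q (fld ω y₂)⟫_ℝ) (kernelMeasure d N Cf) := by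
  have hexp : (fun ω : Cfg d N => ⟪fld ω x₁, C.q (fld ω y₁)⟫_ℝ * ⟪fld ω x₂, C.q (fld ω y₂)⟫_ℝ) = fun ω =>
      ∑ i : Fin N, ∑ k : Fin N,
        (⟪fld ω x₁, EuclideanSpace.basisFun (Fin N) ℝ i⟫_ℝ * (⟪fld ω y₁, C.q (EuclideanSpace.basisFun (Fin N) ℝ i)⟫_ℝ *
          (⟪fld ω x₂, EuclideanSpace.basisFun (Fin N) ℝ k⟫_ℝ * ⟪fld ω y₂, C.q (EuclideanSpace.basisFun (Fin N) ℝ k)⟫_ℝ))) := by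
    funext ω
    rw [inner_q_expand C (fld ω x₁), inner_q_expand C (fld ω x₂), neg_mul_neg, Finset.sum_mul_sum]
    refine Finset.sum_congr rfl fun i _ => Finset.sum_congr rfl fun k _ => ?_
    ring
  rw [hexp]
  exact integrable_finsetSum _ fun i _ => integrable_finsetSum _ fun k _ => integrable_inner4K hK _ _ _ _ _ _ _ _

/-- **THE `q`-CONTRACTION OF (2.26) for the Gaussian field of a colour-diagonal kernel `δ_{ab}C(x − y)`**: `∫⟪φ(x₁),qφ(y₁)⟫⟪φ(x₂),qφ(y₂)⟫dμ_C
= tr q²·(C(x₁−y₂)C(y₁−x₂) − C(x₁−x₂)C(y₁−y₂))` — the self-contraction of each factor vanishes (`⟪u,qu⟫ = 0`, i.e. (2.25)),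
the cross contractions give `−tr q²·C C` and `+tr q²·C C` (the torus file's `B3WTWick.moment_qq`). [cite: Balaban1983Higgs3, (2.26) p.431] -/
theorem integral_inner_q_inner_qK (hK : IsPosSemidefKernel (scalarKernel d N Cf)) (x₁ y₁ x₂ y₂ : ZSite d) :
    ∫ ω, ⟪fld ω x₁, C.q (fld ω y₁)⟫_ℝ * ⟪fld ω x₂, C.q (fld ω y₂)⟫_ℝ ∂kernelMeasure d N Cf =
      trE (C.q.comp C.q) * (Cf (x₁ - y₂) * Cf (y₁ - x₂) - Cf (x₁ - x₂) * Cf (y₁ - y₂)) := by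
  set e := EuclideanSpace.basisFun (Fin N) ℝ with he
  have hexp : ∀ ω : Cfg d N, ⟪fld ω x₁, C.q (fld ω y₁)⟫_ℝ * ⟪fld ω x₂, C.q (fld ω y₂)⟫_ℝ =
      ∑ i : Fin N, ∑ k : Fin N,
        (⟪fld ω x₁, e i⟫_ℝ * (⟪fld ω y₁, C.q (e i)⟫_ℝ * (⟪fld ω x₂, e k⟫_ℝ * ⟪fld ω y₂, C.q (e k)⟫_ℝ))) := by
    intro ω
    rw [inner_q_expand C (fld ω x₁), inner_q_expand C (fld ω x₂), neg_mul_neg, Finset.sum_mul_sum]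
    refine Finset.sum_congr rfl fun i _ => Finset.sum_congr rfl fun k _ => ?_
    ring
  have hik : ∀ i k : Fin N, ∫ ω, ⟪fld ω x₁, e i⟫_ℝ * (⟪fld ω y₁, C.q (e i)⟫_ℝ * (⟪fld ω x₂, e k⟫_ℝ * ⟪fld ω y₂, C.q (e k)⟫_ℝ))
      ∂kernelMeasure d N Cf =
      (Cf (x₁ - x₂) * Cf (y₁ - y₂)) * (⟪e i, e k⟫_ℝ * ⟪C.q (e i), C.q (e k)⟫_ℝ)
        + (Cf (x₁ - y₂) * Cf (y₁ - x₂)) * (⟪e i, C.q (e k)⟫_ℝ * ⟪C.q (e i), e k⟫_ℝ) := by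
    intro i k
    rw [integral_inner4K hK, inner_q_self]
    ring
  simp_rw [hexp]
  rw [integral_finsetSum _ (fun i _ => integrable_finsetSum _ fun k _ => integrable_inner4K hK _ _ _ _ _ _ _ _)]
  have hsum : ∀ i : Fin N, ∫ ω, ∑ k : Fin N, ⟪fld ω x₁, e i⟫_ℝ * (⟪fld ω y₁, C.q (e i)⟫_ℝ *
      (⟪fld ω x₂, e k⟫_ℝ * ⟪fld ω y₂, C.q (e k)⟫_ℝ)) ∂kernelMeasure d N Cf =
      ∑ k : Fin N, ((Cf (x₁ - x₂) * Cf (y₁ - y₂)) * (⟪e i, e k⟫_ℝ * ⟪C.q (e i), C.q (e k)⟫_ℝ)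
        + (Cf (x₁ - y₂) * Cf (y₁ - x₂)) * (⟪e i, C.q (e k)⟫_ℝ * ⟪C.q (e i), e k⟫_ℝ)) := by
    intro i
    rw [integral_finsetSum _ (fun k _ => integrable_inner4K hK _ _ _ _ _ _ _ _)]
    exact Finset.sum_congr rfl fun k _ => hik i k
  simp_rw [hsum]
  simp only [Finset.sum_add_distrib, ← Finset.mul_sum]
  rw [he, sum_inner_mul_inner_qq C, sum_inner_mul_inner_q_q C]
  ring

/-! ### The instance `C = C^η_{M²}`: the free measure `dμ_{C^η_{M²}}` of `B3WTFreeMeasure` (statements as landed) -/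

omit C in
/-- (instance `C = C^η_{M²}`, the free measure) the Gram form of two field insertions: `G(⟪φ(x),v⟫, ⟪φ(y),u⟫) = C^η_{M²}(x − y)⟪v, u⟫`. [cite: Balaban1983Higgs3, (2.26) p.431] -/
theorem gram_cvec {S₀ : Finset (ZSite d)} {x y : ZSite d} (hx : x ∈ S₀) (hy : y ∈ S₀)
    (v u : EuclideanSpace ℝ (Fin N)) :
    gram (freeKernel d N η M2) (S₀ ×ˢ (Finset.univ : Finset (Fin N))) (cvec x v) (cvec y u) =
      CetaM d η M2 (x - y) * ⟪v, u⟫_ℝ :=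
  gram_cvecK hx hy v u

omit C in
/-- (instance `C = C^η_{M²}`, the free measure) **the two-point function of the field at free boundary conditions**: `∫⟪φ(x),v⟫⟪φ(y),u⟫dμ_{C^η_{M²}} = C^η_{M²}(x − y)⟪v,u⟫`.
[cite: Balaban1983Higgs3, (2.26) p.431] -/
theorem integral_inner_fld_inner_fld (hη : 0 < η) (hM : 0 < M2) (x y : ZSite d) (v u : EuclideanSpace ℝ (Fin N)) :
    ∫ ω, ⟪fld ω x, v⟫_ℝ * ⟪fld ω y, u⟫_ℝ ∂freeMeasure d N η M2 = CetaM d η M2 (x - y) * ⟪v, u⟫_ℝ :=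
  integral_inner_fld_inner_fldK (isPosSemidefKernel_freeKernel hη hM) x y v u

omit C in
/-- (instance `C = C^η_{M²}`, the free measure) integrability of the product of two field insertions. [cite: Balaban1983Higgs3, (2.26) p.431] -/
theorem integrable_inner_fld_inner_fld (hη : 0 < η) (hM : 0 < M2) (x y : ZSite d) (v u : EuclideanSpace ℝ (Fin N)) :
    Integrable (fun ω => ⟪fld ω x, v⟫_ℝ * ⟪fld ω y, u⟫_ℝ) (freeMeasure d N η M2) :=
  integrable_inner_fld_inner_fldK (isPosSemidefKernel_freeKernel hη hM) x y v u

omit C in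
/-- (instance `C = C^η_{M²}`, the free measure) **operator form of the two-point function**: `∫⟪φ(x),Qφ(y)⟫dμ_{C^η_{M²}} = C^η_{M²}(x − y)·tr Q` for every operator `Q` on
`R^N` (e.g. `Q = q²`: the single-propagator terms of (2.26)). [cite: Balaban1983Higgs3, (2.26) p.431] -/
theorem integral_inner_fld_op (hη : 0 < η) (hM : 0 < M2) (x y : ZSite d)
    (Q : EuclideanSpace ℝ (Fin N) →L[ℝ] EuclideanSpace ℝ (Fin N)) :
    ∫ ω, ⟪fld ω x, Q (fld ω y)⟫_ℝ ∂freeMeasure d N η M2 = CetaM d η M2 (x - y) * trE Q :=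
  integral_inner_fld_opK (isPosSemidefKernel_freeKernel hη hM) x y Q

omit C in
/-- (instance `C = C^η_{M²}`, the free measure) integrability of `⟪φ(x),Qφ(y)⟫`. [cite: Balaban1983Higgs3, (2.26) p.431] -/
theorem integrable_inner_fld_op (hη : 0 < η) (hM : 0 < M2) (x y : ZSite d)
    (Q : EuclideanSpace ℝ (Fin N) →L[ℝ] EuclideanSpace ℝ (Fin N)) :
    Integrable (fun ω => ⟪fld ω x, Q (fld ω y)⟫_ℝ) (freeMeasure d N η M2) :=
  integrable_inner_fld_opK (isPosSemidefKernel_freeKernel hη hM) x y Q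

omit C in
/-- (instance `C = C^η_{M²}`, the free measure) **WICK'S THEOREM FOR FOUR FIELD INSERTIONS at free boundary conditions**: for `ℓ_a = ⟪φ(x_a),v_a⟫` and
`c_{ab} = C^η_{M²}(x_a − x_b)⟪v_a,v_b⟫`, `∫ℓ₁ℓ₂ℓ₃ℓ₄ dμ_{C^η_{M²}} = c₁₂c₃₄ + c₁₃c₂₄ + c₁₄c₂₃` (the torus file's
`B3WTWick.moment4`, now for the infinite-volume measure). [cite: Balaban1983Higgs3, (2.26) p.431] -/
theorem integral_inner4 (hη : 0 < η) (hM : 0 < M2) (x₁ x₂ x₃ x₄ : ZSite d) (v₁ v₂ v₃ v₄ : EuclideanSpace ℝ (Fin N)) :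
    ∫ ω, ⟪fld ω x₁, v₁⟫_ℝ * (⟪fld ω x₂, v₂⟫_ℝ * (⟪fld ω x₃, v₃⟫_ℝ * ⟪fld ω x₄, v₄⟫_ℝ)) ∂freeMeasure d N η M2 =
      CetaM d η M2 (x₁ - x₂) * ⟪v₁, v₂⟫_ℝ * (CetaM d η M2 (x₃ - x₄) * ⟪v₃, v₄⟫_ℝ)
        + CetaM d η M2 (x₁ - x₃) * ⟪v₁, v₃⟫_ℝ * (CetaM d η M2 (x₂ - x₄) * ⟪v₂, v₄⟫_ℝ)
        + CetaM d η M2 (x₁ - x₄) * ⟪v₁, v₄⟫_ℝ * (CetaM d η M2 (x₂ - x₃) * ⟪v₂, v₃⟫_ℝ) :=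
  integral_inner4K (isPosSemidefKernel_freeKernel hη hM) x₁ x₂ x₃ x₄ v₁ v₂ v₃ v₄

omit C in
/-- (instance `C = C^η_{M²}`, the free measure) integrability of the product of four field insertions. [cite: Balaban1983Higgs3, (2.26) p.431] -/
theorem integrable_inner4 (hη : 0 < η) (hM : 0 < M2) (x₁ x₂ x₃ x₄ : ZSite d) (v₁ v₂ v₃ v₄ : EuclideanSpace ℝ (Fin N)) :
    Integrable (fun ω => ⟪fld ω x₁, v₁⟫_ℝ * (⟪fld ω x₂, v₂⟫_ℝ * (⟪fld ω x₃, v₃⟫_ℝ * ⟪fld ω x₄, v₄⟫_ℝ)))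
      (freeMeasure d N η M2) :=
  integrable_inner4K (isPosSemidefKernel_freeKernel hη hM) x₁ x₂ x₃ x₄ v₁ v₂ v₃ v₄

/-- (instance `C = C^η_{M²}`, the free measure) integrability of the `q`-contraction integrand. [cite: Balaban1983Higgs3, (2.26) p.431] -/
theorem integrable_inner_q_inner_q (hη : 0 < η) (hM : 0 < M2) (x₁ y₁ x₂ y₂ : ZSite d) :
    Integrable (fun ω => ⟪fld ω x₁, C.q (fld ω y₁)⟫_ℝ * ⟪fld ω x₂, C.q (fld ω y₂)⟫_ℝ) (freeMeasure d N η M2) :=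
  integrable_inner_q_inner_qK C (isPosSemidefKernel_freeKernel hη hM) x₁ y₁ x₂ y₂

/-- (instance `C = C^η_{M²}`, the free measure) **THE `q`-CONTRACTION OF (2.26) at free boundary conditions**: `∫⟪φ(x₁),qφ(y₁)⟫⟪φ(x₂),qφ(y₂)⟫dμ_{C^η_{M²}}
= tr q²·(C(x₁−y₂)C(y₁−x₂) − C(x₁−x₂)C(y₁−y₂))` — the self-contraction of each factor vanishes (`⟪u,qu⟫ = 0`, i.e. (2.25)),
the cross contractions give `−tr q²·C C` and `+tr q²·C C` (the torus file's `B3WTWick.moment_qq`). [cite: Balaban1983Higgs3, (2.26) p.431] -/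
theorem integral_inner_q_inner_q (hη : 0 < η) (hM : 0 < M2) (x₁ y₁ x₂ y₂ : ZSite d) :
    ∫ ω, ⟪fld ω x₁, C.q (fld ω y₁)⟫_ℝ * ⟪fld ω x₂, C.q (fld ω y₂)⟫_ℝ ∂freeMeasure d N η M2 =
      trE (C.q.comp C.q) * (CetaM d η M2 (x₁ - y₂) * CetaM d η M2 (y₁ - x₂) - CetaM d η M2 (x₁ - x₂) * CetaM d η M2 (y₁ - y₂)) :=
  integral_inner_q_inner_qK C (isPosSemidefKernel_freeKernel hη hM) x₁ y₁ x₂ y₂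

end Fields

end Literature.MathematicalPhysics.QuantumFieldTheory.Balaban1983to89.B3WTFreeWick

end
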